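/-
Copyright: the b2b-balaban cell (near-miss cell 7), T⁴-continuum fan-out, round-2 swarm seat t4-ne7b-formalise-leaf-09
(row S3 of the lineage t4-ne7b-p1's claim table `t4/b2b-balaban-t4-ne7b-p1/LEAVES-NE7b.md`; node U5c COUNT member).
Released under the licence of the surrounding project.
-/
import Summits.QuantumFields.BalabanUV.T4Continuum.Support.HistoryGenFresh

/-!
# History genealogies, part 8: `Forest` from UNIQUE PARENTS

Summits-side support leaf of the T⁴-continuum cell (rung (B)+1 on a FINITE torus only; NOT infinite volume, NOT the
mass gap, NOT the Clay statement; NOT a proof of the spine estimate NE7b).  Round-2 swarm `t4-ne7b-formalise-*`, row S3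
(seat leaf-09).  [folklore] finite bookkeeping over the lineage's OWN carrier; nothing printed is asserted; no
`[cite:]` tag.

WHY.  The assembly's `HistoryAssemblyPedigree.PedigreeReading.forest` (row S12) and part 3's `freshT_genT` ask
`Pedigree.Forest c` for every component: old parts at different positions have DISJOINT ANCESTRIES — a statement
about the recursively defined `names`.  What the supplier knows is LOCAL: in print a component of step `j` is a part of
EXACTLY ONE component of step `j + 1`, and a component's constituents are listed once.  This file proves that these two
local facts imply `Forest`.

WHAT.  `Pedigree.UniqueParent` (an old name occurs in the part list of at most one component) and `Pedigree.OldNodup c`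
(no old name occurs twice in `parts c`) — parametrised predicates on our data; `parent_mem_names` (if `d` is an old
part of `x` and `d` lies strictly inside the ancestry of `z`, then `x` lies in the ancestry of `z`), `names_comparable`
(two ancestries sharing a name are nested), and **`forest_of_uniqueParent : P.UniqueParent → (∀ c, P.OldNodup c) →
∀ c, P.Forest c`**.

HONEST DEPENDENCY (cell): continuum YM on T⁴ ⇐ BetaPertH ∧ nine spine estimates (0/9 proved); BetaPertH ⇐ (D1) ∧ (D4)
∧ CAP+tail.  This file changes none of it.
-/

open Finset
open Literature.MathematicalPhysics.QuantumFieldTheory.Balaban1983to89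
open T4PersistenceDictionary

namespace Summit.QuantumFields.BalabanUV.T4Continuum.HistoryGen

namespace Pedigree

variable {α π : Type*} [DecidableEq α] (P : Pedigree α π)

/-- **UNIQUE PARENT**: an old name occurs in the part list of at most one component (in print: a component of step `j`
is a part of exactly one component of step `j + 1`).  A parametrised predicate on our data. [folklore] -/
def UniqueParent : Prop :=
  ∀ c c' d (r r' : Bool), Part.old d r ∈ P.parts c → Part.old d r' ∈ P.parts c' → c = c'

/-- **NO REPEATED CONSTITUENT**: two old parts at different positions of `parts c` have different names. [folklore] -/
def OldNodup : α → Prop := fun c =>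
  (P.parts c).Pairwise fun p q => ∀ c₁ r₁ c₂ r₂, p = Part.old c₁ r₁ → q = Part.old c₂ r₂ → c₁ ≠ c₂

variable {P}

/-- **THE PARENT OF A STRICT ANCESTOR IS AN ANCESTOR**: if `d` is an old part of `x` and `d` lies in the ancestry of `z`
with `d ≠ z`, then (unique parents) `x` lies in the ancestry of `z`. [folklore] -/
theorem parent_mem_names (hU : P.UniqueParent) {d x : α} {r : Bool} (hdx : Part.old d r ∈ P.parts x) (z : α)
    (hdz : d ∈ P.names z) (hne : d ≠ z) : x ∈ P.names z := by
  rcases (P.mem_names_iff).1 hdz with rfl | ⟨e, r', he, hde⟩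
  · exact absurd rfl hne
  · by_cases hde' : d = e
    · subst hde'
      rw [hU x z d r r' hdx he]
      exact P.mem_names_self z
    · have hlt := P.step_lt z e r' he
      exact P.names_subset_of_old he (parent_mem_names hU hdx e hde hde')
termination_by P.step z
decreasing_by exact hlt

/-- **ANCESTRIES SHARING A NAME ARE NESTED** (unique parents). [folklore] -/
theorem names_comparable (hU : P.UniqueParent) (x y : α) {a : α} (hax : a ∈ P.names x) (hay : a ∈ P.names y) :
    x ∈ P.names y ∨ y ∈ P.names x := by
  rcases (P.mem_names_iff).1 hax with rfl | ⟨d, r, hd, had⟩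
  · exact Or.inl hay
  · have hlt := P.step_lt x d r hd
    rcases names_comparable hU d y had hay with hdy | hyd
    · by_cases hdy' : d = y
      · subst hdy'
        exact Or.inr (P.names_subset_of_old hd (P.mem_names_self d))
      · exact Or.inl (parent_mem_names hU hd y hdy hdy')
    · exact Or.inr (P.names_subset_of_old hd hyd)
termination_by P.step x
decreasing_by exact hlt

/-- **`Forest` FROM UNIQUE PARENTS**: with unique parents and no repeated constituent, old parts at different
positions of a part list have disjoint ancestries. [folklore] -/
theorem forest_of_uniqueParent (hU : P.UniqueParent) (hN : ∀ c, P.OldNodup c) (c : α) : P.Forest c := by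
  have hNc := hN c
  unfold OldNodup at hNc
  unfold Forest
  refine List.Pairwise.imp_of_mem ?_ hNc
  intro p q hp hq hpq c₁ r₁ c₂ r₂ hp' hq'
  subst hp' hq'
  have hne : c₁ ≠ c₂ := hpq c₁ r₁ c₂ r₂ rfl rfl
  rw [Finset.disjoint_left]
  intro a ha₁ ha₂
  rcases names_comparable hU c₁ c₂ ha₁ ha₂ with h12 | h21
  · have hc : c ∈ P.names c₂ := parent_mem_names hU hp c₂ h12 hne
    have := P.step_le_of_mem_names c₂ c hc
    have := P.step_lt c c₂ r₂ hq
    omega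
  · have hc : c ∈ P.names c₁ := parent_mem_names hU hq c₁ h21 (Ne.symm hne)
    have := P.step_le_of_mem_names c₁ c hc
    have := P.step_lt c c₁ r₁ hp
    omega

end Pedigree

end Summit.QuantumFields.BalabanUV.T4Continuum.HistoryGen
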